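import Literature.NumberTheory.Sieve.MatomakiRadziwillTheorem3VK
import Literature.NumberTheory.LFunctions.VinogradovZetaSumEstimate
import HarnessLib

/-!
# parity.S38 holds: Matomäki–Radziwiłł in almost all short intervals (discharge)

Topic `Literature/NumberTheory/Sieve`.  Everything in this file is PROVED; no definitions, no named facts.

DISCHARGE of the Wave-0 named fact `Literature.NumberTheory.Sieve.matomaki_radziwill`
(`ParityWave0.lean`, **parity.S38**), the *qualitative* form of

> **Theorem 1** (K. Matomäki, M. Radziwiłł, *Multiplicative functions in short intervals*, Ann. of
> Math. (2) 183 (2016), 1015–1056, Theorem 1, p. 1016 = arXiv:1501.04585, p. 1): "Let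
> `f : ℕ → [-1, 1]` be a multiplicative function.  There exist absolute constants `C, C' > 1` such
> that for any `2 ≤ h ≤ X` and `δ > 0`,
> `|h⁻¹ ∑_{x ≤ n ≤ x+h} f(n) − X⁻¹ ∑_{X ≤ n ≤ 2X} f(n)| ≤ δ + C' log log h / log h`
> for all but at most `C X ((log h)^{1/3}/(δ² h^{δ/25}) + 1/(δ² (log X)^{1/50}))` integers
> `x ∈ [X, 2X]`."  ("Note that Theorem 1 allows `h, δ` and `f` to vary uniformly.")

namely: for real multiplicative `|f| ≤ 1`, `h = h(X) → ∞` with `h ≤ X` and every `ε > 0`, the number of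
integers `x ∈ [X, 2X]` with `|(1/h) ∑_{x < n ≤ x+h} f(n) − (1/X) ∑_{X < n ≤ 2X} f(n)| ≥ ε` is `o(X)`.

The theorem cannot sit inside `ParityWave0.lean` (the Matomäki–Radziwiłł files import that module), so
this is the sibling `…Holds` module, as for parity.S19 and parity.S21.  It only joins two results already
in the tree:

* `matomaki_radziwill_of_vk : 0 < c → HasVKZeroFreeRegion c T₀ → matomaki_radziwill`
  (`MatomakiRadziwillTheorem3VK.lean`) — the paper's own chain, proved there and below it:
  parity.S38 ⇐ Theorem 1 (`matomaki_radziwill_of_theorem1`, `MatomakiRadziwill.lean`: take `δ = ε/4`,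
  the endpoint terms and `C' log log h / log h` are eventually `< ε/4`, the exceptional-set bound over
  `X` tends to `0` as `h → ∞`) ⇐ Theorem 3 + the density of `𝒮`, §9
  (`MatomakiRadziwill2016_theorem1_of_theorem3`, `MatomakiRadziwillTheorem1.lean`) ⇐ Lemma 14
  (Parseval) + Lemma 4 (Lipschitz) + Lemma 5 + Proposition 1, §9 ⇐ Lemmas 3, 7, 9, 11, 12, 13, §8,
  with Lemmas 3 and 11 from a Vinogradov–Korobov zero-free region (`MatomakiRadziwill2016_theorem3_of_vk`);
* `LFunctions.VKZeta.exists_hasVKZeroFreeRegion : ∃ c > 0, HasVKZeroFreeRegion c 21`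
  (`LFunctions/VinogradovZetaSumEstimate.lean`) — the Vinogradov–Korobov region, proved in the tree from
  Vinogradov's mean value theorem (Ivić 1985, Lemmas 6.1–6.3, Theorem 6.2; `LFunctions/Vinogradov*.lean`).

(Equivalently `matomaki_radziwill_of_theorem1 MatomakiRadziwill2016_theorem1_holds`, with the discharge
of Theorem 1 in `MatomakiRadziwillProofs.lean`.)  Axiom closure: `propext`, `Classical.choice`,
`Quot.sound`.

## References
* K. Matomäki, M. Radziwiłł, *Multiplicative functions in short intervals*, Ann. of Math. (2) 183
  (2016), no. 3, 1015–1056, doi:10.4007/annals.2016.183.3.6, arXiv:1501.04585: Theorem 1 (p. 1016)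
  and its proof, §9. [cite: MatomakiRadziwillAnnals2016, Theorem 1]
* A. Ivić, *The Riemann Zeta-Function* (Wiley 1985), Lemmas 6.1–6.3 and Theorem 6.2 (Vinogradov's
  mean value theorem and zeta-sum estimate, the source of the zero-free region). [cite: Ivic1985, Theorem 6.2]
-/

namespace Literature.NumberTheory.Sieve

/-- **DISCHARGE of `matomaki_radziwill`** (parity.S38; Matomäki–Radziwiłł, Ann. of Math. 183 (2016),
Theorem 1, qualitative form): for a real multiplicative `f` with `|f| ≤ 1`, `h = h(X) → ∞` with
`h ≤ X`, and `ε > 0`, the number of integers `x ∈ [X, 2X]` with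
`|(1/h) ∑_{x < n ≤ x+h} f(n) − (1/X) ∑_{X < n ≤ 2X} f(n)| ≥ ε` is `o(X)`.  Proof: the tree's
unconditional Vinogradov–Korobov zero-free region (`LFunctions.VKZeta.exists_hasVKZeroFreeRegion`) fed
into the proved chain Theorem 3 ⇒ Theorem 1 ⇒ parity.S38 of the paper (`matomaki_radziwill_of_vk`).
[cite: MatomakiRadziwillAnnals2016, Theorem 1] -/
theorem matomaki_radziwill_holds : matomaki_radziwill := by
  obtain ⟨c, hc, hVK⟩ := Literature.NumberTheory.LFunctions.VKZeta.exists_hasVKZeroFreeRegion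
  exact matomaki_radziwill_of_vk hc hVK

end Literature.NumberTheory.Sieve
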